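import Summits.ABC.IUTFork.Joshi.FundamentalEstimateBL

/-!
# [J-III] §7.4: special precompact subsets, Corollaries 7.4.1 and 7.4.2 (typed, NOT asserted)

Companion of `Joshi/FundamentalEstimateBL.lean` (block E of the abc-iut cell, rung LADDER-ABC:A2.E, seat abc-iut-E-t12,
slot T-12 = plan/E/OBJECTS.tsv O-024; node ids J3:Cor7.4.1, J3:Cor7.4.2 + the unnumbered §7.4 definition). SOURCE:
K. Joshi, arXiv:2401.13508**v4** (unrefereed; bib `Joshi2024ATS3`), §7.4 "Some corollaries of the fundamental estimates",
printed pp. 56–57; locators «p.N l.a–b» = PDF page / line of the cell's render (printed page = PDF page − 1); the cited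
one-prime inputs are [J-IIp] = arXiv:2303.01662v3 (bib `Joshi2023ATS2Local`).

FRAMING (binding): types a third party's unrefereed construction for the TEST against the cell's residual
`S = Summit.ABC.IUTFork.Cor312Vol.PilotKummerIndRelated`; NO side taken on [IUTchIII] Cor. 3.12, on Joshi's claims or on
Mochizuki's 2024 report; typed ≠ proved; typed AS A CANDIDATE ≠ endorsed; nothing here bears on abc. Statements Joshi
ASSERTS are `@[claim "Joshi2024ATS3" "disputed"] def … : Prop` (never axiom / instance / `sorry` / Literature fact);
every `theorem` is DERIVED over the typed signature `AdelicThetaDatum` of the companion file (interim carrier rule;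
merge-debts listed there). OUR-SIDE ANALOGUE (not bound here): Cor. 7.4.1's "`∞ > |Φ|`" by precompactness ↔
`Summit.ABC.IUTFork.Cor312.Setting.ThetaFinite` ("`−|log(Θ)|` is finite … from the compactness of the `𝒰_{j,v_ℚ}`",
proof of Cor. 3.12 p.175 l.2–4) — a dictionary row for E3, nothing more.

FAITHFULNESS FLAGS for the referee lanes (E-ref), not adjudicated: (F-b) Cor. 7.4.2 AS PRINTED lacks the exponent `ℓ*`
of its cited source Thm. 7.3.1 — both forms typed, `cor742_of_asPrinted` proved; (F-c) Def. 7.2.7 takes `ρ ∈ (0,1]`,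
the proof of Cor. 7.4.1 takes `sup_{0<ρ<1}`; (F-d) the uniform-in-`ρ` bound of the proof of Cor. 7.4.1 ("evidently
bounded", p.57 l.7–8) is typed as the hypothesis `UniformNormBound`; at each FIXED `0 < ρ < 1` it IS derived here from
precompactness + continuity of the norms (`sizeAt_pi_lt_top`); (F-e) the strict lower bound of Cor. 7.4.1 needs
`𝕍^{odd,ss} ≠ ∅` (the render shows a damaged subscript «`w∈𝕍^{odd,ss}, p ≠ ∅`» under the product).
-/

noncomputable section

open Set Finset

namespace Summit.ABC.IUTFork.Joshi.ATS3

namespace AdelicThetaDatum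

variable (D : AdelicThetaDatum)

/-! ## 1. §7.4: special precompact subsets and Corollary 7.4.1 (J3:§7.4-def, J3:Cor7.4.1) -/

/-- "precompact i.e. the closure of `Φ_w` in `B^{ℓ*}_{E′_w}` is compact (for the Fréchet-topology)" ([J-III] §7.4 (2),
p.56 l.117–121), for the product of the Fréchet topologies on the `ℓ*` coordinates.
[claim: Joshi2024ATS3, status: disputed] -/
def IsPrecompactAt (w : D.W) (Φw : Set (Fin D.lstar → D.B w)) : Prop :=
  letI : TopologicalSpace (D.B w) := D.top w
  IsCompact (closure Φw)

/-- The product subset `Φ = ∏_{w ∈ 𝕍_{L′}} Φ_w ⊂ B^{ℓ*}_{L′}` of a family of local subsets (§7.4, p.56 l.112–114).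
[claim: Joshi2024ATS3, status: disputed] -/
def pi (Φ : ∀ w : D.W, Set (Fin D.lstar → D.B w)) : Set D.Tuple := Set.pi Set.univ Φ

/-- **[J-III] §7.4, "special precompact subset"** (p.56 l.111–121, verbatim): "A subset `Φ = ∏_{w∈𝕍_{L′}} Φ_w ⊂
B^{ℓ*}_{L′}` is said to be a special precompact subset if (1) `Φ` contains the lifts of theta values arising from
special point `z_Θ` constructed in Theorem 7.3.1, i.e. `Ξ_{z_Θ} ∈ Φ`, and (2) for every `w ∈ 𝕍^{odd,ss}`, the factor
`Φ_w ⊂ B^{ℓ*}_{E′_w}` is precompact i.e. the closure of `Φ_w` in `B^{ℓ*}_{E′_w}` is compact (for the Fréchet-topology)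
and for all other primes `w ∈ 𝕍_{L′}`, `Φ_w = {1}`." (`1 = ([1],…,[1])`, (6.5.1).)
[claim: Joshi2024ATS3, status: disputed] -/
structure IsSpecialPrecompact (Φ : ∀ w : D.W, Set (Fin D.lstar → D.B w)) : Prop where
  /-- (1) `Ξ_{z_Θ} ∈ Φ` -/
  std_mem : ∀ w, D.Xi D.std w ∈ Φ w
  /-- (2a) `Φ_w` precompact for `w ∈ 𝕍^{odd,ss}` -/
  precompact : ∀ w ∈ D.Vss, D.IsPrecompactAt w (Φ w)
  /-- (2b) `Φ_w = {1}` for all other `w` -/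
  eq_one_off : ∀ w, w ∉ D.Vss → Φ w = {fun _ => D.one w}

/-- `Ξ_{z_Θ}` lies in the product set of a special precompact family. [folklore] -/
theorem Xi_std_mem_pi {Φ : ∀ w : D.W, Set (Fin D.lstar → D.B w)} (hΦ : D.IsSpecialPrecompact Φ) :
    D.Xi D.std ∈ D.pi Φ := fun w _ => hΦ.std_mem w

/-- Members of the product set of a special precompact family are `([1],…,[1])` off `𝕍^{odd,ss}`. [folklore] -/
theorem eq_one_off_of_mem_pi {Φ : ∀ w : D.W, Set (Fin D.lstar → D.B w)} (hΦ : D.IsSpecialPrecompact Φ)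
    {x : D.Tuple} (hx : x ∈ D.pi Φ) (w : D.W) (hw : w ∉ D.Vss) : x w = fun _ => D.one w := by
  have h := hx w (Set.mem_univ w)
  rw [hΦ.eq_one_off w hw] at h
  exact h

/-- **The step of the proof of Cor. 7.4.1 typed as a hypothesis** (p.57 l.3–8, verbatim): "As any finite extension of
`ℚ_p` is locally compact, special precompactness of `Φ` is equivalent to `Φ_w` being a bounded subset of `B^{ℓ*}_{E′_w}`
for all `w ∈ 𝕍_{L′}` (for the Fréchet topology) and as the set of `𝕍^{odd,ss}` is finite, so `sup_{0<ρ<1} |Φ|_{B_{L′},ρ}` is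
evidently bounded" — read as: the norms `|x_j|_{B,ρ}` of the members of each `Φ_w`, `w ∈ 𝕍^{odd,ss}`, are bounded
UNIFORMLY in `ρ ∈ (0,1]`. FLAG (F-d): at each fixed `0 < ρ < 1` this bound is DERIVED below from precompactness
(`exists_nrm_le_of_precompact`); the uniformity in `ρ` is the printed "evidently". NOT asserted. -/
@[claim "Joshi2024ATS3" "disputed"]
def UniformNormBound (Φ : ∀ w : D.W, Set (Fin D.lstar → D.B w)) : Prop :=
  ∀ w ∈ D.Vss, ∃ C : ℝ, ∀ x ∈ Φ w, ∀ ρ ∈ Set.Ioc (0 : ℝ) 1, ∀ j, D.nrm w ρ (x j) ≤ C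

/-- **[J-III] Corollary 7.4.1** (p.56 l.122–137, verbatim): "With the hypothesis of the Theorem 7.3.1. Suppose
`Φ ⊂ Θ̃^{B_{L′}}_Joshi` is a special precompact subset of `Θ̃^{B_{L′}}_Joshi` in the sense of § 7.4, then one has
`∞ > |Φ|_{B_{L′}} > ∏_{w∈𝕍^{odd,ss}} |q_w^{1/2ℓ}|^{ℓ*}_{C_{p_w}}`." (The render shows a damaged subscript
«`w∈𝕍^{odd,ss}, p ≠ ∅`» under the product; the strict lower bound needs `𝕍^{odd,ss} ≠ ∅`, cf.
`cor741_lower_of_localThetaEstimateAt`.) NOT asserted; both halves are DERIVED below over named hypotheses. -/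
@[claim "Joshi2024ATS3" "disputed"]
def Cor741 : Prop :=
  ∀ Φ : ∀ w : D.W, Set (Fin D.lstar → D.B w), D.pi Φ ⊆ D.locus → D.IsSpecialPrecompact Φ →
    D.size (D.pi Φ) < ⊤ ∧ ((D.qBound : ℝ) : EReal) < D.size (D.pi Φ)

/-- **Cor. 7.4.1, lower bound — DERIVED** from §7.4 (1) `Ξ_{z_Θ} ∈ Φ` and the local step of Thm. 7.3.1 at one
`ρ ∈ (0,1]`, strictly when `𝕍^{odd,ss} ≠ ∅` (the proof text proves only the finiteness half and leaves this half to
Thm. 7.3.1). [folklore] -/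
theorem cor741_lower_of_localThetaEstimateAt {Φ : ∀ w : D.W, Set (Fin D.lstar → D.B w)}
    (hΦ : D.IsSpecialPrecompact Φ) (hne : D.Vss.Nonempty) {ρ : ℝ} (hρ : ρ ∈ Set.Ioc (0 : ℝ) 1)
    (h : D.LocalThetaEstimateAt ρ) : ((D.qBound : ℝ) : EReal) < D.size (D.pi Φ) :=
  (EReal.coe_lt_coe_iff.2 (D.qBound_lt_adelicSize_std h hne)).trans_le
    (D.adelicSize_le_size (D.Xi_std_mem_pi hΦ) hρ)

/-- The product bound behind both finiteness statements: if on each `Φ_w`, `w ∈ 𝕍^{odd,ss}`, the coordinate norms at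
`ρ` are bounded by `C w`, then every member of `∏_w Φ_w` (trivial off `𝕍^{odd,ss}`) has `(B_{L′},ρ)`-size at most
`∏_{w∈𝕍^{odd,ss}} (max (C w) 0)^{ℓ*}` ("as the set of `𝕍^{odd,ss}` is finite", p.57 l.7). [folklore] -/
theorem adelicSize_le_of_bounds {Φ : ∀ w : D.W, Set (Fin D.lstar → D.B w)} (hΦ : D.IsSpecialPrecompact Φ)
    {ρ : ℝ} {C : D.W → ℝ} (hC : ∀ w ∈ D.Vss, ∀ x ∈ Φ w, ∀ j, D.nrm w ρ (x j) ≤ C w)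
    {x : D.Tuple} (hx : x ∈ D.pi Φ) :
    D.adelicSize ρ x ≤ ∏ w ∈ D.Vss, (max (C w) 0) ^ D.lstar := by
  rw [D.adelicSize_eq_prod_of_off (D.eq_one_off_of_mem_pi hΦ hx) ρ]
  refine Finset.prod_le_prod (fun w _ => D.localSize_nonneg w ρ (x w)) fun w hw => ?_
  unfold localSize
  calc ∏ j, D.nrm w ρ (x w j) ≤ ∏ _j : Fin D.lstar, max (C w) 0 :=
        Finset.prod_le_prod (fun j _ => D.nrm_nonneg w ρ (x w j))
          fun j _ => (hC w hw (x w) (hx w (Set.mem_univ w)) j).trans (le_max_left _ _)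
    _ = (max (C w) 0) ^ D.lstar := by simp

/-- **Cor. 7.4.1, finiteness `∞ > |Φ|_{B_{L′}}` — DERIVED** from the printed step `UniformNormBound` (p.57 l.3–8).
[folklore] -/
theorem cor741_finite_of_uniformNormBound {Φ : ∀ w : D.W, Set (Fin D.lstar → D.B w)}
    (hΦ : D.IsSpecialPrecompact Φ) (hU : D.UniformNormBound Φ) : D.size (D.pi Φ) < ⊤ := by
  classical
  choose! C hC using hU
  refine lt_of_le_of_lt ?_ (EReal.coe_lt_top (∏ w ∈ D.Vss, (max (C w) 0) ^ D.lstar))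
  refine iSup₂_le fun ρ hρ => D.sizeAt_le_coe fun x hx => ?_
  exact D.adelicSize_le_of_bounds hΦ (fun w hw x hx j => hC w hw x hx ρ hρ j) hx

/-- **Cor. 7.4.1 from its two named printed inputs** (the local step of Thm. 7.3.1 at some `ρ ∈ (0,1]` and the
uniform norm bound), for `𝕍^{odd,ss} ≠ ∅`. DERIVED. [folklore] -/
theorem cor741_of_hyps (hne : D.Vss.Nonempty) {ρ : ℝ} (hρ : ρ ∈ Set.Ioc (0 : ℝ) 1) (h : D.LocalThetaEstimateAt ρ)
    (hU : ∀ Φ : ∀ w : D.W, Set (Fin D.lstar → D.B w), D.IsSpecialPrecompact Φ → D.UniformNormBound Φ) :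
    D.Cor741 := fun Φ _ hΦ =>
  ⟨D.cor741_finite_of_uniformNormBound hΦ (hU Φ hΦ), D.cor741_lower_of_localThetaEstimateAt hΦ hne hρ h⟩

/-- **At a FIXED `0 < ρ < 1` the norm bound IS a consequence of precompactness** (continuity of `|−|_{B,ρ}` for the
Fréchet topology and compactness of the closure: a continuous function is bounded on a compact set). DERIVED —
this is the part of "evidently bounded" (p.57 l.7–8) the kernel confirms; the uniformity in `ρ` is FLAG (F-d).
[folklore] -/
theorem exists_nrm_le_of_precompact {w : D.W} {Φw : Set (Fin D.lstar → D.B w)} (hΦ : D.IsPrecompactAt w Φw)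
    {ρ : ℝ} (hρ : ρ ∈ Set.Ioo (0 : ℝ) 1) (j : Fin D.lstar) : ∃ C : ℝ, ∀ x ∈ Φw, D.nrm w ρ (x j) ≤ C := by
  letI : TopologicalSpace (D.B w) := D.top w
  have hK : IsCompact (closure Φw) := hΦ
  have hf : Continuous fun x : Fin D.lstar → D.B w => D.nrm w ρ (x j) :=
    (D.continuous_nrm w ρ hρ).comp (continuous_apply j)
  obtain ⟨C, hC⟩ := hK.bddAbove_image hf.continuousOn
  exact ⟨C, fun x hx => hC (Set.mem_image_of_mem _ (subset_closure hx))⟩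

/-- **`|Φ|_{B_{L′},ρ} < ∞` at each fixed `0 < ρ < 1` for a special precompact `Φ` — DERIVED** from precompactness
alone (no uniformity hypothesis). [folklore] -/
theorem sizeAt_pi_lt_top {Φ : ∀ w : D.W, Set (Fin D.lstar → D.B w)} (hΦ : D.IsSpecialPrecompact Φ) {ρ : ℝ}
    (hρ : ρ ∈ Set.Ioo (0 : ℝ) 1) : D.sizeAt (D.pi Φ) ρ < ⊤ := by
  classical
  have hb : ∀ w, w ∈ D.Vss → ∀ j : Fin D.lstar, ∃ C : ℝ, ∀ x ∈ Φ w, D.nrm w ρ (x j) ≤ C :=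
    fun w hw j => D.exists_nrm_le_of_precompact (hΦ.precompact w hw) hρ j
  choose! C hC using hb
  refine lt_of_le_of_lt (D.sizeAt_le_coe fun x hx => ?_)
    (EReal.coe_lt_top (∏ w ∈ D.Vss, (max (∑ j, max (C w j) 0) 0) ^ D.lstar))
  refine D.adelicSize_le_of_bounds hΦ (fun w hw x hx j => ?_) hx
  exact ((hC w hw j x hx).trans (le_max_left _ 0)).trans
    (Finset.single_le_sum (f := fun j => max (C w j) 0) (fun j _ => le_max_right _ _) (Finset.mem_univ j))

/-! ## 2. Corollary 7.4.2 (J3:Cor7.4.2) -/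

/-- **[J-IIp] Lem. 8.4.1 / the input of Prop. 9.4.1 as Cor. 7.4.2 uses it**: the locus lies in `(B^+)^{ℓ*}`
coordinatewise at every `w` ("`Θ̃ ⊂ B^{+ℓ*}`", [J-IIp] Lem. 8.4.1 p.24 l.24–45; invoked at [J-III] p.57 l.30–32 "for
each `w ∈ 𝕍^{odd,ss}`, and `ρ = 1`, one can apply [Joshi, 2023b, Proposition 9.4.1]"; off `𝕍^{odd,ss}` it is the
statement `[1] ∈ B^+`). Typed as the hypothesis Cor. 7.4.2 cites (E-t3 derives the one-prime case). NOT asserted. -/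
@[claim "Joshi2023ATS2Local" "disputed"]
def LocusInBplus : Prop := ∀ z w j, D.Xi z w j ∈ D.Bplus w

/-- The right-hand side of Cor. 7.4.2 AS PRINTED: `∏_{w∈𝕍^{odd,ss}} |q_w^{1/2ℓ}|_{C_{p_w}} = ∏_w |q_w|^{1/(2ℓ)}` (p.57
l.19–28) — WITHOUT the exponent `ℓ*` of Thm. 7.3.1. [claim: Joshi2024ATS3, status: disputed] -/
def qBoundOne : ℝ := ∏ w ∈ D.Vss, D.qAbs w ^ ((1 : ℝ) / (2 * D.ell))

/-- **[J-III] Corollary 7.4.2, AS PRINTED** (p.57 l.9–29, verbatim): "In the notation of Theorem 7.3.1, and with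
`ρ = 1`, one has `1 ≥ |Θ̃^{B_{L′}}_Joshi|_{B_{L′},1} ≥ ∏_{w∈𝕍^{odd,ss}} |q_w^{1/2ℓ}|_{C_{p_w}}`. Proof. The upper bound follows
from the fact that for each `w ∈ 𝕍^{odd,ss}`, and `ρ = 1`, one can apply [Joshi, 2023b, Proposition 9.4.1]. The
lower bound is Theorem 7.3.1." FLAG (F-b): the printed lower bound omits the exponent `ℓ*` of its cited source
and is STRONGER than it (`|q_w| < 1`), cf. `cor742_of_asPrinted`. NOT asserted. -/
@[claim "Joshi2024ATS3" "disputed"]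
def Cor742AsPrinted : Prop :=
  D.sizeAt D.locus 1 ≤ 1 ∧ ((D.qBoundOne : ℝ) : EReal) ≤ D.sizeAt D.locus 1

/-- **Cor. 7.4.2 with the exponent of its cited source** (`ℓ*` restored: what "the lower bound is Theorem 7.3.1"
yields at `ρ = 1`) — OUR READING of a typographical slip, recorded beside the printed form, not instead of it.
NOT asserted. -/
@[claim "Joshi2024ATS3" "disputed"]
def Cor742 : Prop :=
  D.sizeAt D.locus 1 ≤ 1 ∧ ((D.qBound : ℝ) : EReal) ≤ D.sizeAt D.locus 1

/-- **Cor. 7.4.2, upper bound `|Θ̃|_{B_{L′},1} ≤ 1` — DERIVED** from `LocusInBplus` and "`B^+ = {|·|_1 ≤ 1}`"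
(the content of [J-IIp] Prop. 9.4.1, applied at each `w ∈ 𝕍^{odd,ss}`, p.57 l.30–32). [folklore] -/
theorem cor742_upper_of_locusInBplus (h : D.LocusInBplus) : D.sizeAt D.locus 1 ≤ 1 := by
  have h1 : ((1 : ℝ) : EReal) = 1 := rfl
  rw [← h1]
  refine D.sizeAt_le_coe ?_
  rintro x ⟨z, rfl⟩
  rw [D.adelicSize_Xi_eq_prod]
  refine Finset.prod_le_one (fun w _ => D.localSize_nonneg w 1 _) fun w _ => ?_
  exact Finset.prod_le_one (fun j _ => D.nrm_nonneg w 1 _) fun j _ => D.nrm_le_one_of_mem_Bplus w _ (h z w j)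

/-- **Cor. 7.4.2, lower bound at `ρ = 1` — DERIVED** from the local step of Thm. 7.3.1 AT `ρ = 1` (which is what
"the lower bound is Theorem 7.3.1" needs at a fixed `ρ`). [folklore] -/
theorem cor742_lower_of_localThetaEstimateAt (h : D.LocalThetaEstimateAt 1) :
    ((D.qBound : ℝ) : EReal) ≤ D.sizeAt D.locus 1 :=
  (EReal.coe_le_coe_iff.2 (D.qBound_le_adelicSize_std h)).trans (D.adelicSize_le_sizeAt (D.Xi_mem_locus D.std) 1)

/-- Cor. 7.4.2 (exponent restored) from its two named inputs. DERIVED. [folklore] -/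
theorem cor742_of_hyps (hB : D.LocusInBplus) (h : D.LocalThetaEstimateAt 1) : D.Cor742 :=
  ⟨D.cor742_upper_of_locusInBplus hB, D.cor742_lower_of_localThetaEstimateAt h⟩

/-- `∏_w |q_w|^{ℓ*/(2ℓ)} ≤ ∏_w |q_w|^{1/(2ℓ)}`: since `0 < |q_w| < 1` and `1 ≤ ℓ*`, the printed right-hand side of
Cor. 7.4.2 dominates that of Thm. 7.3.1. [folklore] -/
theorem qBound_le_qBoundOne : D.qBound ≤ D.qBoundOne := by
  refine Finset.prod_le_prod (fun w hw => (D.qFactor_pos hw).le) fun w hw => ?_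
  refine Real.rpow_le_rpow_of_exponent_ge (D.qAbs_pos w hw) (D.qAbs_lt_one w hw).le ?_
  have h2 : (0 : ℝ) < 2 * D.ell := by have := D.ell_pos; positivity
  have h1 : (1 : ℝ) ≤ D.lstar := by exact_mod_cast le_trans (by norm_num) D.two_le_lstar
  exact div_le_div_of_nonneg_right h1 h2.le

/-- **The printed Cor. 7.4.2 implies the exponent-restored form** (FLAG (F-b): AS PRINTED it is the stronger
statement). DERIVED. [folklore] -/
theorem cor742_of_asPrinted (h : D.Cor742AsPrinted) : D.Cor742 :=
  ⟨h.1, (EReal.coe_le_coe_iff.2 D.qBound_le_qBoundOne).trans h.2⟩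

/-- Cor. 7.4.2 (either form) yields Thm. 7.3.1's inequality, since `|Θ̃|_{B_{L′},1} ≤ |Θ̃|_{B_{L′}}`. DERIVED. [folklore] -/
theorem fundamentalEstimateBL_of_cor742 (h : D.Cor742) : D.FundamentalEstimateBL :=
  h.2.trans (D.sizeAt_le_size D.locus ⟨one_pos, le_rfl⟩)

end AdelicThetaDatum

end Summit.ABC.IUTFork.Joshi.ATS3

end
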